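import Literature.IUT.HodgeArakelov.GoodPrimeFrobenioidMonoidsProofs
import Literature.IUT.HodgeArakelov.GaussianMonoidsGood
import HarnessLib

/-!
# [IUTchII] Prop 4.2 (iii), (iv) / Prop 4.4 (iii), (iv): labeled copies and the theta / Gaussian monoids on
# the Frobenioid side — REAL constructions over abc-iut-L6-t2's `ConstantMonoidDatum`, with proofs

S. Mochizuki, *Inter-universal Teichmüller theory II*, §4, kurims manuscript (Dec. 2020), Proposition 4.2
(iii), (iv) pp. 124–125 (`v ∈ V^good ∩ V^non`) and Proposition 4.4 (iii), (iv) pp. 130–131 (`v ∈ V^arc`),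
read on the page (lit key `paper:url-5036b4059555`, pp. 120–131) [cite: Mochizuki2012, Prop 4.2 (iv) p.125].
Claim key DISPUTED (D-0012). Printed proofs: "The various assertions of Proposition 4.2 follow immediately
from the definitions and the references quoted in the statements of these assertions." (p. 125) and the
same sentence for Proposition 4.4 (p. 131). Companion of
`GoodPrimeKummerBridge.lean` ((i), (ii): the unique equivariant isomorphism `φ` of constant monoids and its
unit part `φ^×`, over abc-iut-L4-t2's [AbsTopIII] §3 pairs); this file needs only `φ` / `φ^×` as a parameter,
so it imports nothing from [AbsTopIII].

WHY THIS FILE. `GoodPrimeFrobenioidMonoids.lean` (abc-iut-L6-t2, p404158) records Prop 4.2 (iii), (iv) and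
Prop 4.4 (iii), (iv) as BARE `Prop` FIELDS `Prop42Statements.symmetrizing` / `.thetaGaussian`,
`Prop44Statements.symmetrizing` / `.thetaGaussian` (slots; DISCHARGE-L6 §E2 LIST B1, §F row F9). Over the
REAL group-theoretic objects of Prop 4.1 / 4.3 typed in `GaussianMonoidsGood.lean` (p404520:
`diagonalSubmonoid`, `diagonalEmbedding`, `diagonalIso`, `ConstantMonoidDatum`, `ThetaMonoid`,
`SemiSimplified`, `evalHom`, `GaussianMonoid`, `evalIso`) the two items are CONSTRUCTIONS, made here.

WHAT THE KERNEL IS MADE TO SAY.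
* (iii) pp. 124–125 / p. 130: "The isomorphism of (i) determines, for each `t ∈ LabCusp^±(†Π_v)`, a
  collection of compatible isomorphisms `(Ψ_{†F_v})_t ⥲ Ψ_cns(†Π_v)_t` […] as well as [`F_l^⋊±`-]symmetrizing
  isomorphisms, […] between the data indexed by distinct `t ∈ LabCusp^±(†Π_v)`. Moreover, these
  symmetrizing isomorphisms determine [various diagonal submonoids, as well as] an isomorphism of
  ind-topological monoids `(Ψ_{†F_v})_0 ⥲ (Ψ_{†F_v})_{⟨F_l^⋇⟩}`": labeled copies
  are literal copies (abc-iut-L6-t2's convention), so the labeled collection is the constant family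
  `labeledIso T φ`; PROVED: it commutes with every relabeling (the symmetrizing isomorphisms,
  `labeledIso_relabel`), carries the diagonal `(Ψ_{†F_v})_{⟨T⟩}` exactly onto `Ψ_cns(†Π_v)_{⟨T⟩}`
  (`labeledIso_mem_diagonalSubmonoid_iff`, `map_labeledIso_diagonalSubmonoid`, `diagonalLabeledIso`) and
  intertwines the two isomorphisms `Ψ_0 ⥲ Ψ_{⟨T⟩}` (`diagonalIso_labeled_comm`). (The "inner automorphism
  of `†Π_v` independent of `t`" indeterminacy is `GoodPrimeKummer.equivariantIsoOver_conj` in the companion.)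
* (iv) p. 125 / pp. 130–131: "Write `Ψ_{†F^Θ_v}`, `Ψ_{F_gau}(†F_v)` for the monoids equipped with
  `G_v(†Π_v)`-actions and natural splittings determined, respectively — via the isomorphisms of (i), (ii),
  and (iii) — by the monoids `Ψ_env(†Π_v)`, `Ψ_gau(†Π_v)`, Galois actions, and splittings of Proposition 4.1,
  (iv)", with "a collection of natural isomorphisms […] `Ψ_{†F^Θ_v} ⥲ Ψ_env(†Π_v) ⥲ Ψ_gau(†Π_v) ⥲ Ψ_{F_gau}(†F_v)`
  — which restrict to the identity or to the [restriction to “`(−)^×`” of the] isomorphism of (i) [or its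
  inverse] on the various copies of `Ψ^×_{†F_v}`, “`Ψ_cns(†Π_v)^×`” and are compatible with the various natural
  actions of `G_v(†Π_v)` and natural splittings": CONSTRUCTED — `frobeniusSide Ψ UF` (the Frobenioid-side datum: units `Ψ^×_{†F_v} = UF`, the
  same `R_{≥0} ∋ log(p_v)` since the realified isomorphism of (ii) is unique, `PointedHalfLine.isoUnique_holds`,
  and is the identity in abc-iut-L6-t2's normalisation), `thetaKummerIso` (`Ψ_{†F^Θ_v} ⥲ Ψ_env(†Π_v)`: `φ^×` on
  units, identity on the ray), `gaussianKummerIso` (`Ψ_gau(†Π_v) ⥲ Ψ_{F_gau}(†F_v)`); PROVED: `φ^×` on the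
  unit copies (`thetaKummerIso_unit`, `coe_gaussianKummerIso_symm_apply`), identity on the splitting rays
  (`thetaKummerIso_ray`), naturality of the formal evaluation map (`evalHom_thetaKummerIso`), the image
  statement `Ψ_{F_gau}(†F_v) ⥲ Ψ_gau(†Π_v)` (`map_labeledIso_gaussianMonoid`) and the chain identity
  "`Ψ_{†F^Θ} ⥲ Ψ_env ⥲ Ψ_gau ⥲ Ψ_{F_gau}` equals the Frobenioid-side formal evaluation isomorphism"
  (`evalIso_chain`). Galois actions: the unit factor carries the action and `φ^×` is equivariant by (i), the
  `R_{≥0}`-factors carry the trivial action (abc-iut-L6-t2 suppresses them in `ConstantMonoidDatum`).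

HONEST FRAMING. Elementary algebra over the cell's own normalisations; nothing here bears on [IUTchIII]
Cor. 3.12 or takes a side; typed ≠ discharged elsewhere.
-/

namespace Literature.IUT.HodgeArakelov

open scoped NNReal

universe u v w

namespace GoodPrimeKummer

/-! ### 1. Prop 4.2 (iii) / 4.4 (iii): labeled copies, symmetrizing isomorphisms, `Ψ_0 ⥲ Ψ_{⟨F_l^⋇⟩}` -/

section Labels

variable {T : Type w} {M : Type u} {N : Type v} [CommMonoid M] [CommMonoid N]

/-- **[IUTchII] Prop 4.2 (iii) / 4.4 (iii)** (pp. 124–125, 130): "The isomorphism of (i) determines, for each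
`t ∈ LabCusp^±(†Π_v)`, a collection of compatible isomorphisms `(Ψ_{†F_v})_t ⥲ Ψ_cns(†Π_v)_t`" — with labeled
copies literal copies (abc-iut-L6-t2, `diagonalSubmonoid`): the constant family of copies of the
isomorphism `φ` of (i), as one isomorphism of the product monoids `∏_t (Ψ_{†F_v})_t ⥲ ∏_t Ψ_cns(†Π_v)_t`.
[cite: Mochizuki2012, Prop 4.2 (iii) p.124] -/
def labeledIso (T : Type w) (φ : M ≃* N) : (T → M) ≃* (T → N) :=
  MulEquiv.piCongrRight fun _ : T => φ

/-- The labeled isomorphism acts by `φ` in each label. [cite: Mochizuki2012, Prop 4.2 (iii) p.124] -/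
@[simp] theorem labeledIso_apply (φ : M ≃* N) (x : T → M) (t : T) : labeledIso T φ x t = φ (x t) := rfl

/-- Compatibility with the **symmetrizing isomorphisms** "between the data indexed by distinct
`t ∈ LabCusp^±(†Π_v)`" (which, on literal copies, are the relabelings): the labeled isomorphism commutes with
every relabeling `σ : T → T` (in particular with the transposition exchanging two labels).
[cite: Mochizuki2012, Prop 4.2 (iii) p.125] -/
theorem labeledIso_relabel (φ : M ≃* N) (σ : T → T) (x : T → M) :
    labeledIso T φ (x ∘ σ) = labeledIso T φ x ∘ σ := rfl

/-- The labeled isomorphism carries the diagonal submonoid `(Ψ_{†F_v})_{⟨T⟩}` EXACTLY onto the diagonal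
submonoid `Ψ_cns(†Π_v)_{⟨T⟩}` (the "various diagonal submonoids" of (iii), p. 125).
[cite: Mochizuki2012, Prop 4.2 (iii) p.125] -/
theorem labeledIso_mem_diagonalSubmonoid_iff (φ : M ≃* N) (x : T → M) :
    labeledIso T φ x ∈ diagonalSubmonoid T N ↔ x ∈ diagonalSubmonoid T M := by
  simp only [mem_diagonalSubmonoid, labeledIso_apply, φ.apply_eq_iff_eq]

/-- … hence maps the diagonal submonoid onto the diagonal submonoid. [cite: Mochizuki2012, Prop 4.2 (iii) p.125] -/
theorem map_labeledIso_diagonalSubmonoid (φ : M ≃* N) :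
    (diagonalSubmonoid T M).map (labeledIso T φ).toMonoidHom = diagonalSubmonoid T N := by
  ext y
  constructor
  · rintro ⟨x, hx, rfl⟩
    exact (labeledIso_mem_diagonalSubmonoid_iff φ x).mpr hx
  · intro hy
    refine ⟨(labeledIso T φ).symm y, ?_, MulEquiv.apply_symm_apply _ _⟩
    have : labeledIso T φ ((labeledIso T φ).symm y) ∈ diagonalSubmonoid T N := by
      rwa [MulEquiv.apply_symm_apply]
    exact (labeledIso_mem_diagonalSubmonoid_iff φ _).mp this

/-- The isomorphism of diagonal submonoids `(Ψ_{†F_v})_{⟨T⟩} ⥲ Ψ_cns(†Π_v)_{⟨T⟩}` induced by the labeled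
isomorphism. [cite: Mochizuki2012, Prop 4.2 (iii) p.125] -/
def diagonalLabeledIso (T : Type w) (φ : M ≃* N) : diagonalSubmonoid T M ≃* diagonalSubmonoid T N :=
  ((labeledIso T φ).submonoidMap (diagonalSubmonoid T M)).trans
    (MulEquiv.submonoidCongr (map_labeledIso_diagonalSubmonoid φ))

/-- Underlying family of `diagonalLabeledIso`: `φ` in each label. [cite: Mochizuki2012, Prop 4.2 (iii) p.125] -/
@[simp] theorem coe_diagonalLabeledIso_apply (φ : M ≃* N) (x : diagonalSubmonoid T M) (t : T) :
    (diagonalLabeledIso T φ x : T → N) t = φ ((x : T → M) t) := rfl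

/-- The labeled isomorphism is compatible with the **diagonal embeddings** `Ψ_0 → ∏_t Ψ_t` of the
zero-labeled copy (abc-iut-L6-t2's `diagonalEmbedding`). [cite: Mochizuki2012, Prop 4.2 (iii) p.125] -/
theorem labeledIso_diagonalEmbedding (φ : M ≃* N) (m : M) :
    labeledIso T φ (diagonalEmbedding T M m) = diagonalEmbedding T N (φ m) := rfl

/-- **[IUTchII] Prop 4.2 (iii), last display** ("an isomorphism of ind-topological monoids
`(Ψ_{†F_v})_0 ⥲ (Ψ_{†F_v})_{⟨F_l^⋇⟩}` compatible with the respective actions by subscripted versions of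
`G_v(†Π_v)`"): the isomorphisms
`Ψ_0 ⥲ Ψ_{⟨T⟩}` of abc-iut-L6-t2 (`diagonalIso`) on the two sides are intertwined by `φ` and its labeled
version — the square `Ψ_{†F_v} ⥲ (Ψ_{†F_v})_{⟨T⟩} ⥲ Ψ_cns(†Π_v)_{⟨T⟩}` = `Ψ_{†F_v} ⥲ Ψ_cns(†Π_v) ⥲ Ψ_cns(†Π_v)_{⟨T⟩}`
commutes. [cite: Mochizuki2012, Prop 4.2 (iii) p.125] -/
theorem diagonalIso_labeled_comm [Nonempty T] (φ : M ≃* N) (m : M) :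
    diagonalLabeledIso T φ (diagonalIso T M m) = diagonalIso T N (φ m) := by
  apply Subtype.ext
  funext t
  rfl

end Labels

/-! ### 2. Prop 4.2 (iv) / 4.4 (iv): theta and Gaussian monoids on the Frobenioid side -/

section ThetaGaussian

/-- **The Frobenioid-side constant-monoid datum** ([IUTchII] Prop 4.2 (iv) p. 125: the monoids on the
`†F_v`-side are "determined, respectively — via the isomorphisms of (i), (ii), and (iii) — by the monoids
`Ψ_env(†Π_v)`, `Ψ_gau(†Π_v)`, Galois actions, and splittings of Proposition 4.1, (iv)"):
units `Ψ^×_{†F_v}` (an abstract commutative group `UF`, identified with `Ψ_cns(†Π_v)^×` by the unit part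
`φ^×` of the isomorphism of (i)) and THE SAME realified part `R_{≥0} ∋ log(p_v)` (the realified isomorphism
of (ii) is unique, `PointedHalfLine.isoUnique_holds`, and is the identity in abc-iut-L6-t2's normalisation
`R_{≥0}(−) := ℝ≥0`). [cite: Mochizuki2012, Prop 4.2 (iv) p.125] -/
abbrev frobeniusSide (Ψ : ConstantMonoidDatum.{u}) (UF : CommGrpCat.{u}) : ConstantMonoidDatum.{u} where
  Units := UF
  logReal := Ψ.logReal

variable (Ψ : ConstantMonoidDatum.{u}) (UF : CommGrpCat.{u}) (φ : UF ≃* Ψ.Units)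

/-- `Ψ_{†F^Θ_v} ⥲ Ψ_env(†Π_v)`, the first "natural isomorphism" of [IUTchII] Prop 4.2 (iv) p. 125 (Prop 4.4
(iv) p. 130: `Ψ_{†F^Θ_v} ⥲ Ψ_env(†U_v)`): `φ^×` on the unit factor, the identity on the ray
`R_{≥0}·log(p_v)·log(Θ)`. [cite: Mochizuki2012, Prop 4.2 (iv) p.125] -/
def thetaKummerIso : (frobeniusSide Ψ UF).ThetaMonoid ≃* Ψ.ThetaMonoid :=
  MulEquiv.prodCongr φ (MulEquiv.refl _)

/-- The induced isomorphism of semi-simplifications `Ψ^ss_{†F_v} ⥲ Ψ^ss_cns(†Π_v)` (Prop 4.2 (ii) p. 124 "a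
natural poly-isomorphism of ind-topological monoids […] that is compatible with the natural splittings on the
domain and codomain", here the member determined by `φ^×`):
`φ^×` on units, identity on `R_{≥0}`. [cite: Mochizuki2012, Prop 4.2 (ii) p.124] -/
def semiSimplifiedKummerIso : (frobeniusSide Ψ UF).SemiSimplified ≃* Ψ.SemiSimplified :=
  MulEquiv.prodCongr φ (MulEquiv.refl _)

/-- Componentwise description of the theta isomorphism. [cite: Mochizuki2012, Prop 4.2 (iv) p.125] -/
@[simp] theorem thetaKummerIso_apply (x : (frobeniusSide Ψ UF).ThetaMonoid) :
    thetaKummerIso Ψ UF φ x = (φ x.1, x.2) := rfl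

/-- Componentwise description of the semi-simplified isomorphism. [cite: Mochizuki2012, Prop 4.2 (ii) p.124] -/
@[simp] theorem semiSimplifiedKummerIso_apply (x : (frobeniusSide Ψ UF).SemiSimplified) :
    semiSimplifiedKummerIso Ψ UF φ x = (φ x.1, x.2) := rfl

/-- "restrict to the identity or to the [restriction to “`(−)^×`” of the] isomorphism of (i) [or its
inverse] on the various copies of `Ψ^×_{†F_v}`, “`Ψ_cns(†Π_v)^×`”": on a unit `(u, 0)` the theta isomorphism is
`φ^×`. [cite: Mochizuki2012, Prop 4.2 (iv) p.125] -/
theorem thetaKummerIso_unit (u : UF) : thetaKummerIso Ψ UF φ (u, 1) = (φ u, 1) := rfl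

/-- "compatible with the various natural actions of `G_v(†Π_v)` and natural splittings": on the ray
`{1} × R_{≥0}·log(p_v)·log(Θ)` the theta isomorphism is the identity. [cite: Mochizuki2012, Prop 4.2 (iv) p.125] -/
theorem thetaKummerIso_ray (c : Multiplicative ℝ≥0) : thetaKummerIso Ψ UF φ (1, c) = (1, c) :=
  Prod.ext (map_one φ) rfl

variable (lstar : ℕ)

/-- **Naturality of the formal evaluation map** ([IUTchII] Prop 4.2 (iv) p. 125: the natural isomorphisms
arise from "the definition of the various monoids involved, together with the formal evaluation isomorphism
of Proposition 4.1, (iv)"): evaluating after `Ψ_{†F^Θ_v} ⥲ Ψ_env(†Π_v)` is the labeled semi-simplified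
isomorphism applied after evaluating on the Frobenioid side. [cite: Mochizuki2012, Prop 4.2 (iv) p.125] -/
theorem evalHom_thetaKummerIso (x : (frobeniusSide Ψ UF).ThetaMonoid) :
    Ψ.evalHom lstar (thetaKummerIso Ψ UF φ x) =
      labeledIso (Fin lstar) (semiSimplifiedKummerIso Ψ UF φ) ((frobeniusSide Ψ UF).evalHom lstar x) := by
  funext j
  rfl

/-- The labeled semi-simplified isomorphism carries the Frobenioid-side Gaussian monoid `Ψ_{F_gau}(†F_v)`
EXACTLY onto `Ψ_gau(†Π_v)`. [cite: Mochizuki2012, Prop 4.2 (iv) p.125] -/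
theorem map_labeledIso_gaussianMonoid :
    ((frobeniusSide Ψ UF).GaussianMonoid lstar).map
        (labeledIso (Fin lstar) (semiSimplifiedKummerIso Ψ UF φ)).toMonoidHom =
      Ψ.GaussianMonoid lstar := by
  ext y
  constructor
  · rintro ⟨x, ⟨z, rfl⟩, rfl⟩
    exact ⟨thetaKummerIso Ψ UF φ z, evalHom_thetaKummerIso Ψ UF φ lstar z⟩
  · rintro ⟨z, rfl⟩
    refine ⟨(frobeniusSide Ψ UF).evalHom lstar ((thetaKummerIso Ψ UF φ).symm z), ⟨_, rfl⟩, ?_⟩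
    change labeledIso (Fin lstar) (semiSimplifiedKummerIso Ψ UF φ)
        ((frobeniusSide Ψ UF).evalHom lstar ((thetaKummerIso Ψ UF φ).symm z)) = Ψ.evalHom lstar z
    rw [← evalHom_thetaKummerIso, MulEquiv.apply_symm_apply]

/-- `Ψ_gau(†Π_v) ⥲ Ψ_{F_gau}(†F_v)`, the third "natural isomorphism" of [IUTchII] Prop 4.2 (iv) p. 125 (4.4 (iv)
p. 130): the inverse of the labeled semi-simplified isomorphism restricted to the Gaussian monoids.
[cite: Mochizuki2012, Prop 4.2 (iv) p.125] -/
def gaussianKummerIso : Ψ.GaussianMonoid lstar ≃* (frobeniusSide Ψ UF).GaussianMonoid lstar :=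
  (((labeledIso (Fin lstar) (semiSimplifiedKummerIso Ψ UF φ)).submonoidMap
      ((frobeniusSide Ψ UF).GaussianMonoid lstar)).trans
    (MulEquiv.submonoidCongr (map_labeledIso_gaussianMonoid Ψ UF φ lstar))).symm

/-- Underlying family of the inverse Gaussian isomorphism: `φ^×` in each label, identity on each
`R_{≥0}`-component ("restrict to the identity or to the […] isomorphism of (i) [or its inverse] on the
various copies", p. 125). [cite: Mochizuki2012, Prop 4.2 (iv) p.125] -/
@[simp] theorem coe_gaussianKummerIso_symm_apply (y : (frobeniusSide Ψ UF).GaussianMonoid lstar)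
    (j : Fin lstar) :
    ((gaussianKummerIso Ψ UF φ lstar).symm y : Fin lstar → Ψ.SemiSimplified) j = (φ (y.1 j).1, (y.1 j).2) :=
  rfl

/-- **The chain identity of [IUTchII] Prop 4.2 (iv)** (p. 125 "a collection of natural isomorphisms […]
`Ψ_{†F^Θ_v} ⥲ Ψ_env(†Π_v) ⥲ Ψ_gau(†Π_v) ⥲ Ψ_{F_gau}(†F_v)`"): composing the theta isomorphism, the
group-theoretic formal evaluation isomorphism `Ψ_env ⥲ Ψ_gau` of Prop 4.1 (iv) (abc-iut-L6-t2's `evalIso`)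
and `Ψ_gau ⥲ Ψ_{F_gau}` gives exactly the Frobenioid-side formal evaluation isomorphism `Ψ_{†F^Θ_v} ⥲ Ψ_{F_gau}(†F_v)`
— the three isomorphisms are mutually compatible. [cite: Mochizuki2012, Prop 4.2 (iv) p.125] -/
theorem evalIso_chain (hl : 0 < lstar) (x : (frobeniusSide Ψ UF).ThetaMonoid) :
    gaussianKummerIso Ψ UF φ lstar (Ψ.evalIso lstar hl (thetaKummerIso Ψ UF φ x)) =
      (frobeniusSide Ψ UF).evalIso lstar hl x := by
  apply (gaussianKummerIso Ψ UF φ lstar).symm.injective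
  rw [MulEquiv.symm_apply_apply]
  apply Subtype.ext
  change Ψ.evalHom lstar (thetaKummerIso Ψ UF φ x) =
    labeledIso (Fin lstar) (semiSimplifiedKummerIso Ψ UF φ) ((frobeniusSide Ψ UF).evalHom lstar x)
  exact evalHom_thetaKummerIso Ψ UF φ lstar x

/-- Units of the Gaussian monoids correspond under `φ^×` label by label: the unit part of the image of a
Frobenioid-side Gaussian element is the (diagonal) family `φ^×(u)` ("on the various copies of `Ψ^×_{†F_v}`,
“`Ψ_cns(†Π_v)^×`”", p. 125). [cite: Mochizuki2012, Prop 4.2 (iv) p.125] -/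
theorem gaussianKummerIso_symm_units (hl : 0 < lstar) (u : UF) (c : Multiplicative ℝ≥0) (j : Fin lstar) :
    (((gaussianKummerIso Ψ UF φ lstar).symm ((frobeniusSide Ψ UF).evalIso lstar hl (u, c)) :
        Fin lstar → Ψ.SemiSimplified) j).1 = φ u := rfl

/-- The ray of `Ψ_{F_gau}(†F_v)` is carried to the ray of `Ψ_gau(†Π_v)` ("compatible with the various natural
actions of `G_v(†Π_v)` and natural splittings", p. 125): the image of `(1, c)` has trivial unit components and the printed weights
`c · j² · log(p_v)` as `R_{≥0}`-components. [cite: Mochizuki2012, Prop 4.2 (iv) p.125] -/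
theorem gaussianKummerIso_symm_ray (hl : 0 < lstar) (c : ℝ≥0) (j : Fin lstar) :
    ((gaussianKummerIso Ψ UF φ lstar).symm
        ((frobeniusSide Ψ UF).evalIso lstar hl (1, Multiplicative.ofAdd c)) : Fin lstar → Ψ.SemiSimplified) j =
      (1, Multiplicative.ofAdd (c * ((labelNat j : ℝ≥0) ^ 2 * Ψ.logReal.logp))) :=
  Prod.ext (map_one φ) rfl

end ThetaGaussian

end GoodPrimeKummer

end Literature.IUT.HodgeArakelov
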